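import Mathlib

/-!
# Route BarrierLever — item `PartitionMinorsHitByVP` (stmt-ValiantsHypothesis-19717), line `hidden-states`:
# THE STAIRCASE FUNCTIONAL (dual vector of the path table for `P_k`) — definitions and the local identity

Helper file (`--supports stmt-ValiantsHypothesis-19717`; cell valiant-natproofs, 𝒟-side door (c), registered line
`Cruxes/PartitionMinorsHitByVP/Lines/hidden_states.lean` v8; prover seat val-np-p6 gen 16).  Closes NO item.  Two definitions
(`PathTable.stairB`, `PathTable.zetaLA`: the k-FREE combinatorial core of the dual vector that certifies the class `P_k` of the first shell of
HALF-BALL for EVERY `k`, memo HOME/val-np-p6/g16/MEMO-valnp6-g16.md §3) and their calculus.  `stairB L A`: the finite sets of naturals `L = {ℓ₁ < … < ℓ_m}` (missing X-levels) and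
`A = {a₁ < … < a_m}` (present Y-values) INTERLACE: `ℓ_i ≤ a_i < ℓ_{i+1}`; order-free form: `|L| = |A|` and every
`ℓ ∈ L` has as many elements of `A` below it as elements of `L` below it.  `zetaLA s L A = (−1)^m (−s)^{ΣA − ΣL}` on
interlacing pairs, `0` otherwise.  Main lemma `zetaLA_local` (memo g16 §3 (L<), k-free form): for `|L| = |A| + 1` and
`A < a`:  `ζ(L, A+a) + s·ζ(L, A+(a−1)) + ζ(L−a, A) = 0` — the three terms are the three SOURCES of the Y-coordinate `a` in the
path table (`y_a = χ_a + s χ_{a−1} + Σ_{level p = a} χ_p`): adding `a`, adding `a−1`, or un-missing the X-element of level `a`.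
Consequences (next files): the staircase functional annihilates every column `y^S`, `S ∈ B_k ∖ {X}`, of the `P_k` matrix and takes the
value `(−1)^k 2^{k−1} s^k` on `y^Y`, whence `det M(P_k) ≠ 0` for every `k` (paper: memo §3; exact checks k ≤ 8).

WHAT THIS IS NOT: no matrix and no item statement appears here; nothing on crux 14610 or VP ≠ VNP.
-/

set_option linter.dupNamespace false

namespace Summit.ValiantsHypothesis.ValiantsHypothesis.Theorems.BarrierLever.HiddenStates

open Finset

noncomputable section

namespace PathTable

/-- `L` and `A` interlace (`ℓ_i ≤ a_i < ℓ_{i+1}` for the sorted enumerations), order-free Boolean test: equal sizes and every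
`ℓ ∈ L` has as many elements of `A` below it as elements of `L` below it. -/
def stairB (L A : Finset ℕ) : Bool :=
  decide (L.card = A.card ∧ ∀ ℓ ∈ L, (A.filter (· < ℓ)).card = (L.filter (· < ℓ)).card)

/-- unfolding of the Boolean interlacing test. -/
theorem stairB_iff (L A : Finset ℕ) :
    stairB L A = true ↔ L.card = A.card ∧ ∀ ℓ ∈ L, (A.filter (· < ℓ)).card = (L.filter (· < ℓ)).card := by
  unfold stairB; exact decide_eq_true_iff

/-- The staircase weight `(−1)^{|A|} (−s)^{ΣA − ΣL}` of an interlacing pair, `0` otherwise. -/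
def zetaLA (s : ℂ) (L A : Finset ℕ) : ℂ :=
  if stairB L A then (-1) ^ A.card * (-s) ^ (∑ x ∈ A, x - ∑ x ∈ L, x) else 0

/-- `ζ` vanishes off interlacing pairs. -/
theorem zetaLA_of_not {s : ℂ} {L A : Finset ℕ} (h : ¬ stairB L A = true) : zetaLA s L A = 0 := by
  simp [zetaLA, h]

/-- `ζ` vanishes when the cardinalities differ. -/
theorem zetaLA_of_card_ne {s : ℂ} {L A : Finset ℕ} (h : L.card ≠ A.card) : zetaLA s L A = 0 :=
  zetaLA_of_not fun hs => h ((stairB_iff L A).1 hs).1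

/-- the empty pair interlaces. -/
theorem stair_empty : stairB ∅ ∅ = true := (stairB_iff _ _).2 ⟨rfl, fun _ h => (Finset.notMem_empty _ h).elim⟩

/-- `ζ(∅, ∅) = 1`. -/
theorem zetaLA_empty (s : ℂ) : zetaLA s ∅ ∅ = 1 := by
  simp [zetaLA, stair_empty]

/-- On an interlacing pair with `L ≠ ∅`: `A ≠ ∅` and `max L ≤ max A`. -/
theorem stair_max_le {L A : Finset ℕ} (hB : stairB L A = true) (hL : L.Nonempty) :
    ∃ hA : A.Nonempty, L.max' hL ≤ A.max' hA := by
  have h := (stairB_iff L A).1 hB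
  have hA : A.Nonempty := by
    rw [← Finset.card_pos, ← h.1, Finset.card_pos]; exact hL
  refine ⟨hA, ?_⟩
  have hcond := h.2 (L.max' hL) (Finset.max'_mem L hL)
  -- the elements of `L` below `max L` are all but one
  have hLlt : (L.filter (· < L.max' hL)).card = L.card - 1 := by
    have : L.filter (· < L.max' hL) = L.erase (L.max' hL) := by
      ext x
      simp only [Finset.mem_filter, Finset.mem_erase]
      constructor
      · rintro ⟨hx, hlt⟩; exact ⟨hlt.ne, hx⟩
      · rintro ⟨hne, hx⟩; exact ⟨hx, lt_of_le_of_ne (Finset.le_max' L x hx) hne⟩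
    rw [this, Finset.card_erase_of_mem (Finset.max'_mem L hL)]
  rw [hLlt, h.1] at hcond
  by_contra hlt
  push Not at hlt
  have hall : A.filter (· < L.max' hL) = A := by
    apply Finset.filter_true_of_mem
    intro a ha
    exact lt_of_le_of_lt (Finset.le_max' A a ha) hlt
  rw [hall] at hcond
  have : 0 < A.card := Finset.card_pos.2 hA
  omega

/-- **Top insertion.**  With `ℓ₀` above `L` and `c` above `A`: `(L + ℓ₀, A + c)` interlace iff `(L, A)` interlace, all
of `A` is below `ℓ₀`, and `ℓ₀ ≤ c`. -/
theorem stair_insert_top {L A : Finset ℕ} {ℓ₀ c : ℕ} (hL : ∀ ℓ ∈ L, ℓ < ℓ₀) (hA : ∀ a ∈ A, a < c) :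
    stairB (insert ℓ₀ L) (insert c A) = true ↔ stairB L A = true ∧ (∀ a ∈ A, a < ℓ₀) ∧ ℓ₀ ≤ c := by
  rw [stairB_iff, stairB_iff]
  have hℓ₀ : ℓ₀ ∉ L := fun h => lt_irrefl _ (hL _ h)
  have hc : c ∉ A := fun h => lt_irrefl _ (hA _ h)
  -- filters of the inserted sets
  have fA : ∀ ℓ, (insert c A).filter (· < ℓ) = if c < ℓ then insert c (A.filter (· < ℓ)) else A.filter (· < ℓ) :=
    fun ℓ => Finset.filter_insert _ _ _
  have fL : ∀ ℓ, (insert ℓ₀ L).filter (· < ℓ) =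
      if ℓ₀ < ℓ then insert ℓ₀ (L.filter (· < ℓ)) else L.filter (· < ℓ) :=
    fun ℓ => Finset.filter_insert _ _ _
  have hcA : ∀ ℓ, c ∉ A.filter (· < ℓ) := fun ℓ h => hc (Finset.mem_filter.1 h).1
  have hLL : ∀ ℓ, ℓ₀ ∉ L.filter (· < ℓ) := fun ℓ h => hℓ₀ (Finset.mem_filter.1 h).1
  have hLall : L.filter (· < ℓ₀) = L := Finset.filter_true_of_mem hL
  constructor
  · rintro ⟨hcard, hcond⟩
    rw [Finset.card_insert_of_notMem hℓ₀, Finset.card_insert_of_notMem hc] at hcard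
    have hcard' : L.card = A.card := by omega
    -- the condition at `ℓ₀`
    have h0 := hcond ℓ₀ (Finset.mem_insert_self _ _)
    rw [fA, fL, if_neg (lt_irrefl _), hLall] at h0
    have hle : ℓ₀ ≤ c := by
      by_contra hlt
      push Not at hlt
      rw [if_pos hlt, Finset.card_insert_of_notMem (hcA _)] at h0
      have hall : A.filter (· < ℓ₀) = A :=
        Finset.filter_true_of_mem fun a ha => (hA a ha).trans hlt
      rw [hall] at h0
      omega
    rw [if_neg (not_lt.2 hle)] at h0
    have hAℓ : ∀ a ∈ A, a < ℓ₀ := by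
      have hsub : A.filter (· < ℓ₀) = A := Finset.eq_of_subset_of_card_le (Finset.filter_subset _ _) (by omega)
      intro a ha
      have : a ∈ A.filter (· < ℓ₀) := by rw [hsub]; exact ha
      exact (Finset.mem_filter.1 this).2
    refine ⟨⟨hcard', fun ℓ hℓ => ?_⟩, hAℓ, hle⟩
    have h1 := hcond ℓ (Finset.mem_insert_of_mem hℓ)
    have hℓlt : ℓ < ℓ₀ := hL ℓ hℓ
    rw [fA, fL, if_neg (fun h => lt_irrefl _ ((hle.trans_lt h).trans hℓlt)),
      if_neg (fun h => lt_irrefl _ (h.trans hℓlt))] at h1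
    exact h1
  · rintro ⟨⟨hcard, hcond⟩, hAℓ, hle⟩
    refine ⟨by rw [Finset.card_insert_of_notMem hℓ₀, Finset.card_insert_of_notMem hc, hcard], fun ℓ hℓ => ?_⟩
    rcases Finset.mem_insert.1 hℓ with rfl | hℓ
    · rw [fA, fL, if_neg (lt_irrefl _), if_neg (not_lt.2 hle), hLall,
        Finset.filter_true_of_mem hAℓ, hcard]
    · have hℓlt : ℓ < ℓ₀ := hL ℓ hℓ
      rw [fA, fL, if_neg (fun h => lt_irrefl _ ((hle.trans_lt h).trans hℓlt)),
        if_neg (fun h => lt_irrefl _ (h.trans hℓlt))]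
      exact hcond ℓ hℓ

/-- a nonempty finite set of naturals is its maximum inserted into the (strictly smaller) rest. -/
theorem eq_insert_max'_erase (L : Finset ℕ) (hL : L.Nonempty) :
    L = insert (L.max' hL) (L.erase (L.max' hL)) ∧ ∀ ℓ ∈ L.erase (L.max' hL), ℓ < L.max' hL := by
  refine ⟨(Finset.insert_erase (Finset.max'_mem L hL)).symm, fun ℓ hℓ => ?_⟩
  obtain ⟨hne, hℓ⟩ := Finset.mem_erase.1 hℓ
  exact lt_of_le_of_ne (Finset.le_max' L ℓ hℓ) hne

/-- On an interlacing pair, `ΣL ≤ ΣA` (termwise `ℓ_i ≤ a_i`). -/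
theorem stair_sum_le {L A : Finset ℕ} (h : stairB L A = true) : ∑ x ∈ L, x ≤ ∑ x ∈ A, x := by
  induction hn : L.card generalizing L A with
  | zero =>
    rw [Finset.card_eq_zero.1 hn]
    simp
  | succ n ih =>
    have hL : L.Nonempty := Finset.card_pos.1 (by omega)
    obtain ⟨hA, -⟩ := stair_max_le h hL
    obtain ⟨eL, ltL⟩ := eq_insert_max'_erase L hL
    obtain ⟨eA, ltA⟩ := eq_insert_max'_erase A hA
    rw [eL, eA] at h
    obtain ⟨h', -, hle⟩ := (stair_insert_top ltL ltA).1 h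
    have ih' := ih h' (by rw [Finset.card_erase_of_mem (Finset.max'_mem L hL)]; omega)
    rw [eL, eA, Finset.sum_insert (Finset.notMem_erase _ _), Finset.sum_insert (Finset.notMem_erase _ _)]
    omega

/-- **Top insertion for `ζ`.** -/
theorem zetaLA_insert_top (s : ℂ) {L A : Finset ℕ} {ℓ₀ c : ℕ} (hL : ∀ ℓ ∈ L, ℓ < ℓ₀) (hA : ∀ a ∈ A, a < c) :
    zetaLA s (insert ℓ₀ L) (insert c A) =
      if (∀ a ∈ A, a < ℓ₀) ∧ ℓ₀ ≤ c then zetaLA s L A * (-((-s) ^ (c - ℓ₀))) else 0 := by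
  have hℓ₀ : ℓ₀ ∉ L := fun h => lt_irrefl _ (hL _ h)
  have hc : c ∉ A := fun h => lt_irrefl _ (hA _ h)
  unfold zetaLA
  by_cases hst : stairB L A = true
  · by_cases hcond : (∀ a ∈ A, a < ℓ₀) ∧ ℓ₀ ≤ c
    · have hbig : stairB (insert ℓ₀ L) (insert c A) = true := (stair_insert_top hL hA).2 ⟨hst, hcond⟩
      rw [if_pos hbig, if_pos hcond, if_pos hst, Finset.card_insert_of_notMem hc,
        Finset.sum_insert hc, Finset.sum_insert hℓ₀]
      have hsum := stair_sum_le hst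
      have hexp : c + ∑ x ∈ A, x - (ℓ₀ + ∑ x ∈ L, x) = (∑ x ∈ A, x - ∑ x ∈ L, x) + (c - ℓ₀) := by
        have := hcond.2; omega
      rw [hexp, pow_add, pow_succ]
      ring
    · have hbig : ¬ stairB (insert ℓ₀ L) (insert c A) = true := fun h => hcond ((stair_insert_top hL hA).1 h).2
      rw [if_neg hbig, if_neg hcond]
  · have hbig : ¬ stairB (insert ℓ₀ L) (insert c A) = true := fun h => hst ((stair_insert_top hL hA).1 h).1
    rw [if_neg hbig]
    split_ifs <;> simp

/-- ★ **THE LOCAL IDENTITY (L<)** (memo val-np-p6 g16 §3, k-free form).  For `|L| = |A| + 1` and all of `A` below `a`: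
`ζ(L, A+a) + s·ζ(L, A+(a−1)) + ζ(L−a, A) = 0` (the middle term only for `a ≥ 1`). -/
theorem zetaLA_local (s : ℂ) {L A : Finset ℕ} {a : ℕ} (hcard : L.card = A.card + 1) (hA : ∀ x ∈ A, x < a) :
    zetaLA s L (insert a A) + (if 1 ≤ a then s * zetaLA s L (insert (a - 1) A) else 0) +
      zetaLA s (L.erase a) A = 0 := by
  have hLne : L.Nonempty := Finset.card_pos.1 (by omega)
  obtain ⟨eL, ltL⟩ := eq_insert_max'_erase L hLne
  set t := L.max' hLne with ht
  set L0 := L.erase t with hL0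
  have haA : a ∉ A := fun h => lt_irrefl _ (hA _ h)
  have hL0card : L0.card = A.card := by
    rw [hL0, Finset.card_erase_of_mem (Finset.max'_mem L hLne)]; omega
  -- the three positions of the top level `t` relative to `a`
  rcases lt_trichotomy t a with hlt | heq | hgt
  · -- (i) t < a : the first two terms cancel, the third vanishes
    have haL : a ∉ L := fun h => lt_irrefl _ ((Finset.le_max' L a h).trans_lt hlt)
    have h3 : zetaLA s (L.erase a) A = 0 := by
      rw [Finset.erase_eq_of_notMem haL]; exact zetaLA_of_card_ne (by omega)
    rw [h3, add_zero]
    have ha1 : 1 ≤ a := by omega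
    rw [if_pos ha1]
    by_cases hpred : ∃ x ∈ A, x = a - 1
    · -- `a − 1 ∈ A`: the middle set is `A` itself (wrong cardinality) and the first condition fails
      obtain ⟨x, hx, hxa⟩ := hpred
      have h2 : insert (a - 1) A = A := Finset.insert_eq_of_mem (hxa ▸ hx)
      rw [h2, zetaLA_of_card_ne (L := L) (A := A) (by omega), mul_zero, add_zero, eL,
        zetaLA_insert_top s ltL hA, if_neg]
      rintro ⟨hall, -⟩
      have := hall x hx
      omega
    · have hA' : ∀ x ∈ A, x < a - 1 := by
        intro x hx
        have h1 := hA x hx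
        by_contra h2
        exact hpred ⟨x, hx, by omega⟩
      rw [eL, zetaLA_insert_top s ltL hA, zetaLA_insert_top s ltL hA']
      by_cases hc : ∀ x ∈ A, x < t
      · rw [if_pos ⟨hc, hlt.le⟩, if_pos ⟨hc, by omega⟩]
        have : a - t = (a - 1 - t) + 1 := by omega
        rw [this, pow_succ]
        ring
      · rw [if_neg (fun h => hc h.1), if_neg (fun h => hc h.1)]
        ring
  · -- (ii) t = a : the first and third terms cancel, the middle one vanishes
    have h3 : zetaLA s (L.erase a) A = zetaLA s L0 A := by rw [hL0, heq]
    have h1 : zetaLA s L (insert a A) = -zetaLA s L0 A := by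
      rw [eL, zetaLA_insert_top s ltL hA, if_pos ⟨fun x hx => heq ▸ hA x hx, heq.le⟩, heq, Nat.sub_self,
        pow_zero]
      ring
    have h2 : (if 1 ≤ a then s * zetaLA s L (insert (a - 1) A) else 0) = 0 := by
      split_ifs with ha1
      · by_cases hpred : a - 1 ∈ A
        · rw [Finset.insert_eq_of_mem hpred, zetaLA_of_card_ne (by omega), mul_zero]
        · have hA' : ∀ x ∈ A, x < a - 1 := by
            intro x hx
            have h1 := hA x hx
            have : x ≠ a - 1 := fun h => hpred (h ▸ hx)
            omega
          rw [eL, zetaLA_insert_top s ltL hA', if_neg, mul_zero]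
          rintro ⟨-, hle⟩
          omega
      · rfl
    rw [h1, h2, h3]; ring
  · -- (iii) t > a : all three terms vanish
    have h1 : zetaLA s L (insert a A) = 0 := by
      rw [eL, zetaLA_insert_top s ltL hA, if_neg]
      rintro ⟨-, hle⟩; omega
    have h2 : (if 1 ≤ a then s * zetaLA s L (insert (a - 1) A) else 0) = 0 := by
      split_ifs with ha1
      · by_cases hpred : a - 1 ∈ A
        · rw [Finset.insert_eq_of_mem hpred, zetaLA_of_card_ne (by omega), mul_zero]
        · have hA' : ∀ x ∈ A, x < a - 1 := by
            intro x hx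
            have h1 := hA x hx
            have : x ≠ a - 1 := fun h => hpred (h ▸ hx)
            omega
          rw [eL, zetaLA_insert_top s ltL hA', if_neg, mul_zero]
          rintro ⟨-, hle⟩; omega
      · rfl
    have h3 : zetaLA s (L.erase a) A = 0 := by
      by_cases haL : a ∈ L
      · apply zetaLA_of_not
        intro hst
        have hne : (L.erase a).Nonempty := ⟨t, Finset.mem_erase.2 ⟨hgt.ne', Finset.max'_mem L hLne⟩⟩
        obtain ⟨hAne, hmax⟩ := stair_max_le hst hne
        have htle : t ≤ (L.erase a).max' hne := Finset.le_max' _ t (Finset.mem_erase.2 ⟨hgt.ne', Finset.max'_mem L hLne⟩)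
        have hAmax : A.max' hAne < a := hA _ (Finset.max'_mem A hAne)
        omega
      · rw [Finset.erase_eq_of_notMem haL]; exact zetaLA_of_card_ne (by omega)
    rw [h1, h2, h3]; ring

end PathTable

end

end Summit.ValiantsHypothesis.ValiantsHypothesis.Theorems.BarrierLever.HiddenStates
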